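import Summits.HodgeConjecture.HodgeConjecture.Theorems.VHCAbelianSchemesRoadServedFibreDefs
import Literature.AlgebraicGeometry.HodgeTheory.TwistedPerfectAdmissibilityInitialSegment
import HarnessLib

/-!
# Road b02 (`VHCAbelianSchemesRoad`, D-0059) — BUCHWEITZ–FLENNER CARRIERS FOR THE PRIMED TWISTED DOOR: the `B₀`-twisted primed
# constructor, the anchored-carrier statement on `I = {1, …, p}`, THE HONEST PRICE (all lower side degrees are forced) and
# MARKMAN'S NORMALISATION `B₀ = −c₁/r` (the degree-one side is free)

research route conditional on HC_CM; not a corollary; Q11.4-sentence-2 already refuted in dim ≥ 3.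

FACT-FREE, door-generic in `Adm ⊇ bfSingleAdmissible'` (in particular the re-keyed crux's `AdmTw' := gluableSigmaAdmissible ∨
bfSingleAdmissible'`, items stmt-HodgeConjecture-20706 ∕ 20707, director-hodge R9.4 ∕ R9.5; LEAD 157 `DOOR-PRIME-PACKAGE.md` 36e61c73e912c4e1),
anchor-generic in `(𝔄, 𝔖)`, degree-generic in `(n, p)`; no `def`, no named fact, `HC_CM` nowhere; nothing of any landed file is edited
(ring2-b03 gen 85, lane R heir, on the package's §iv ∕ §v.2: «the two content constructors of §iv (b03 g81∕g82) are the only landed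
statements whose primed twin is a real lemma (κ₂ on the ray); owner = lane R heir»). The instances at the elliptic-power ∕ Lefschetz-fibre
anchors and the primed `(6,3)` residual reductions are the companion file `VHCAbelianSchemesRoadSecantQuotientResidualSpecialFibrePrime`.

WHY. The BF disjunct of the door of record (`bfSingleAdmissible`: a vector bundle `F` in degree `0`, `{q | q+1 ∈ I}`-semiregular) was typed on
ARBITRARY index sets `I`, and this lineage's carrier constructors (`anchoredCarrierAt_twisted_of_forall_exists_isISemiregular`, b03 g81;
`lefschetzCarrierAt_twisted_…`, g82) used `I = {p}`: only `σ_{p−1}` tested, NO side degree typed. Print supports the `B`-twisted criterion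
only when `{q | q+1 ∈ I}` is an INITIAL SEGMENT (Pridham Rem. 2.26 with Cor. 2.25: `σ^{B₀}_q = Σ_{i ≤ q} (B₀^i/i!) ∪ σ_{q−i}` is unipotent
lower-triangular in `(σ_q)_q`), whence `bfSingleAdmissible' := bfSingleAdmissible ∧ I.IsShiftedInitialSegment` (p537197) and the primed door.
On the primed BF disjunct a datum with `p ∈ I` has `{1, …, p} ⊆ I` (§1), so the anchored-carrier statement's side clause
`κ_q = c_q·θ^q (q ∈ I, q ≠ p)` now bites in EVERY degree `1 ≤ q < p`: at `(6,3)`, `κ₁ ∈ ℂθ` and `κ₂ ∈ ℂθ²` in addition to `κ₃ = a·w + c₃·θ³`.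

* §1 INDEX SETS: `Icc_subset_of_mem_of_isShiftedInitialSegment` (`p ∈ I`, `I` shifted-initial ⟹ `Finset.Icc 1 p ⊆ I`);
  `setOf_succ_mem_Icc` (`{q | q+1 ∈ Icc 1 p} = Set.Iio p`: the semiregularity tested on `Icc 1 p` is `{0, …, p−1}`-semiregularity, i.e.
  joint injectivity of `(σ₀, …, σ_{p−1})` on `Ext²(F,F)` — WEAKER than the `{p−1}`-semiregularity of the `I = {p}` constructors, by
  `IsISemiregular.mono`).
* §2 PRIMED CONSTRUCTORS for every `Adm ⊇ bfSingleAdmissible'`: `twistedReflexiveClass_of_isISemiregular_twisted_prime` (the `B₀`-twisted twin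
  of b06 g120's `twistedReflexiveClass_of_isISemiregular_prime`); `anchoredCarrierAt_twisted_of_forall_exists_isISemiregular_prime` (sheaf data on
  any shifted-initial `I ∋ p` with all sides) and `…_Icc` (on `I = Icc 1 p`: `F` `{0,…,p−1}`-semiregular, `B₀` rational algebraic,
  `(e^{B₀} ch F)_p = a·w + c_p·θᵖ`, `(e^{B₀} ch F)_q = c_q·θ^q` for `1 ≤ q < p`).
* §3 THE HONEST PRICE AS A THEOREM: `anchoredCarrierAt_bfSingle'_iff` — for the primed BF door `tw C bfSingleAdmissible'` the anchored-carrier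
  statement IS the sheaf-level design problem of §2 (⟹ unpacks the single-sheaf model, `chPerfect = ch F`; ⟸ is §2); corollary
  `forall_lowerSides_of_anchoredCarrierAt_bfSingle'`: EVERY primed BF-carrier has ALL of `(e^{B₀} ch F)_q`, `1 ≤ q < p`, on the `θ`-ray.
  The disjunctive door: `twistedReflexiveClass_or_iff` (a member for `P ∨ Q` is a member for `P` or for `Q`), so an `AdmTw'`-carrier is, anchor by
  anchor, a σ-gluable datum or a primed BF datum paying this price; `anchoredCarrierAt_or_of_right` (BF′-carriers are `AdmTw'`-carriers).
* §4 MARKMAN'S NORMALISATION (`κ(F) := ch(F)·e^{−c₁(F)/r}`, arXiv:2502.03415 §1.1): `expTwistCh_one_of_ch_zero` (`(e^{B} ch F)₁ = ch₁ + r·B` when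
  `ch₀ = r·1`), `expTwistCh_one_markman_eq_zero` (`B₀ := −ch₁(F)/r` ⟹ `(e^{B₀} ch F)₁ = 0`), rationality and algebraicity of that `B₀`, and the
  constructor `anchoredCarrierAt_twisted_of_forall_exists_markman`: for `p ≥ 2`, vector bundles `F` of rank `r ∈ ℚ^×` (`ch₀(F) = r·1`),
  `{0,…,p−1}`-semiregular, with `κ_q(F) ∈ ℂθ^q` for `2 ≤ q < p` and `κ_p(F) = a·w + c·θᵖ` give the primed anchored-carrier statement — the
  degree-one side is DISCHARGED, `B₀` is not a datum any more. At `(6,3)`: «`F` `{0,1,2}`-semiregular, `κ₂(F) ∈ ℂθ²`, `κ₃(F) ∈ ℂ^×·w + ℂθ³`»;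
  at `(n,2)` (`anchoredCarrierAt_two_twisted_of_forall_exists_markman`) NO side condition at all — the first cell pays only `{0,1}`- for `{1}`-semiregularity.

HONEST READING. The new side conditions are what the TYPED primed door asks; in nature they also return through the deformation theory the
door encodes (a semiregular `B`-twisted object whose `κ_p` stays Hodge deforms, so all its `κ_q` stay Hodge along the pencil — Pridham Cor. 2.25),
and along a very general `U(3,3)` Weil pencil the first-order Hodge classes in degree `4` are `ℂθ²` (this lineage's INF-NL-UNIFORM memo, b06 g121
×2), so `κ₂ ∈ ℂθ²` is forced there anyway. Nothing here says any carrier statement, cell, rung, crux, K-SR♭∃, VHC, `HC_AV` or HC holds.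
References: [cite: BuchweitzFlenner2003, Def. 4.1, §5 (I-semiregular), Thm. 5.1] [cite: Pridham2024Semiregularity, Cor. 2.25 and Rem. 2.26]
[cite: Perry2026Semiregularity, Thm. 1.1 and Def. 2.4] [cite: Markman2025SecantWeil, §1.1 (κ-class) and §7.3] [cite: HuybrechtsStellari2005, §1]
[cite: Fulton1998, Example 3.2.3 and §15.1] [cite: Bloch1972Semiregularity, Remark (7.5)].
-/

noncomputable section

open CategoryTheory CategoryTheory.Limits AlgebraicGeometry Topology

-- the cell's namespace repeats the summit name (`Summit.HodgeConjecture.HodgeConjecture…`), as in every `Ring2*` file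
set_option linter.dupNamespace false

namespace Summit.HodgeConjecture.HodgeConjecture.Ring2.SemiregularRepresentatives

open Literature.AlgebraicGeometry Literature.AlgebraicGeometry.Motives Literature.AlgebraicGeometry.Modules
open Literature.AlgebraicGeometry.HodgeTheory
open Literature.AlgebraicGeometry.KTheory (IsBoundedVBComplex)
open Literature.AlgebraicTopology.SingularHomology
open Summit.Ventures.HSemireg (ObjClass)

/-! ## §1 Index sets: on an initial segment, `p ∈ I` forces `{1, …, p} ⊆ I`; the degrees tested on `{1, …, p}` are `{0, …, p−1}` -/

/-- **`p ∈ I` and `{q | q+1 ∈ I}` downward closed ⟹ `{1, …, p} ⊆ I`** — the index sets of primed BF data containing the served degree `p`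
contain every lower positive degree. [cite: BuchweitzFlenner2003, §5 (I-semiregular)] [cite: Pridham2024Semiregularity, Rem. 2.26 with Cor. 2.25] -/
theorem Icc_subset_of_mem_of_isShiftedInitialSegment {I : Finset ℕ} {p : ℕ} (hp : p ∈ I) (hI : I.IsShiftedInitialSegment) :
    Finset.Icc 1 p ⊆ I := by
  intro q hq
  obtain ⟨h1, hqp⟩ := Finset.mem_Icc.1 hq
  obtain ⟨p', rfl⟩ : ∃ p', p = p' + 1 := ⟨p - 1, (Nat.sub_add_cancel (le_trans h1 hqp)).symm⟩
  obtain ⟨q', rfl⟩ : ∃ q', q = q' + 1 := ⟨q - 1, (Nat.sub_add_cancel h1).symm⟩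
  exact hI p' hp q' (Nat.le_of_succ_le_succ hqp)

/-- **The degrees tested on `I = {1, …, p}` are `{0, …, p−1}`**: `{q | q + 1 ∈ Finset.Icc 1 p} = Set.Iio p` (so `{0,…,p−1}`-semiregularity,
joint injectivity of `(σ₀, …, σ_{p−1})`). [cite: BuchweitzFlenner2003, §5 (I-semiregular)] -/
theorem setOf_succ_mem_Icc (p : ℕ) : {q | q + 1 ∈ Finset.Icc 1 p} = Set.Iio p := by
  ext q
  simp only [Set.mem_setOf_eq, Finset.mem_Icc, Set.mem_Iio]
  omega

/-- `{q | q + 1 ∈ {p}} ⊆ {q | q + 1 ∈ {1, …, p}}`: the single degree `p − 1` tested by the `I = {p}` constructors is among `{0, …, p−1}`, so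
`{p−1}`-semiregularity IMPLIES the semiregularity the primed constructors ask (`IsISemiregular.mono`). [cite: BuchweitzFlenner2003, §5 (I-semiregular)] -/
theorem setOf_succ_mem_singleton_subset (p : ℕ) : {q | q + 1 ∈ ({p} : Finset ℕ)} ⊆ {q | q + 1 ∈ Finset.Icc 1 p} := by
  intro q hq
  have h : q + 1 = p := Finset.mem_singleton.1 hq
  simp only [Set.mem_setOf_eq, Finset.mem_Icc]
  omega

/-! ## §2 Primed constructors (`Adm ⊇ bfSingleAdmissible'`) -/

section Constructors

variable {C : ChernCharacterBetti} {Adm : PerfectAdmissibility} {n p : ℕ}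

/-- **An `{q | q+1 ∈ I}`-semiregular vector bundle `E₀` with a rational algebraic `B`-field is a member of the twisted door for every
`Adm ⊇ bfSingleAdmissible'`, PROVIDED `{q | q+1 ∈ I}` is an initial segment** (`κ_q = (e^{B₀} ch E₀)_q`, `q ∈ I`; witness `E₀[0]`): the
`B₀`-twisted twin of `twistedReflexiveClass_of_isISemiregular_prime` (b06 g120), i.e. the tree's `twistedReflexiveClass_of_isISemiregular_twisted`
run at `bfSingleAdmissible` plus the index conjunct. [cite: Perry2026Semiregularity, Thm. 1.1 (hypotheses)]
[cite: BuchweitzFlenner2003, §5 (I-semiregular)] [cite: Pridham2024Semiregularity, Rem. 2.26 with Cor. 2.25] -/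
theorem twistedReflexiveClass_of_isISemiregular_twisted_prime {X₀ : SchemeOver ℂ} {I : Finset ℕ}
    {κ : (q : ℕ) → complexBetti X₀ (2 * q)} (hAdm' : ∀ n X₀ I E, bfSingleAdmissible' n X₀ I E → Adm n X₀ I E) (E₀ : X₀.left.Modules)
    (hE₀ : IsFiniteLocallyFree E₀) (hsr : IsISemiregular hE₀ {q | q + 1 ∈ I}) (hI : I.IsShiftedInitialSegment) {B₀ : complexBetti X₀ 2}
    (hBr : IsRationalClass B₀) (hBa : B₀ ∈ algebraicClasses X₀ 1) (hκ : ∀ q ∈ I, κ q = expTwistCh C X₀ B₀ E₀ q) :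
    twistedReflexiveClass C Adm n X₀ I κ := by
  obtain ⟨E, hE, B, hA, hBr', hBa', hκ'⟩ := twistedReflexiveClass_of_isISemiregular_twisted (C := C) (n := n)
    (Adm := bfSingleAdmissible) (fun _ _ _ _ h => h) E₀ hE₀ hsr hBr hBa hκ
  exact ⟨E, hE, B, hAdm' _ _ _ _ ⟨hA, hI⟩, hBr', hBa', hκ'⟩

variable {𝔄 : ∀ X : SchemeOver ℂ, complexBetti X 2 → Prop} {𝔖 : ∀ (X : SchemeOver ℂ), complexBetti X 2 → Set (complexBetti X (2 * p))}

/-- **SHEAF DATA ON A SHIFTED-INITIAL INDEX SET `I ∋ p` WITH ALL SIDES ON THE `θ`-RAY GIVE THE ANCHORED-CARRIER STATEMENT for the twisted door,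
every `Adm ⊇ bfSingleAdmissible'`**: at every anchor and served rational `w`, a finite locally free `F`, `{q | q+1 ∈ I}`-semiregular, a rational
algebraic `B₀`, `a ≠ 0`, scalars `c_q` with `(e^{B₀} ch F)_p = a·w + c_p·θᵖ` and `(e^{B₀} ch F)_q = c_q·θ^q` (`q ∈ I ∖ {p}`).
[cite: BuchweitzFlenner2003, §5 (I-semiregular) and Thm. 5.1] [cite: Pridham2024Semiregularity, Cor. 2.25 and Rem. 2.26] [cite: Bloch1972Semiregularity, Remark (7.5)] -/
theorem anchoredCarrierAt_twisted_of_forall_exists_isISemiregular_prime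
    (hAdm' : ∀ n X₀ I E, bfSingleAdmissible' n X₀ I E → Adm n X₀ I E)
    (h : ∀ (X : SchemeOver ℂ) (θ : complexBetti X 2), 𝔄 X θ → ∀ w ∈ 𝔖 X θ, IsRationalClass w →
      ∃ (I : Finset ℕ) (F : X.left.Modules) (hF : IsFiniteLocallyFree F) (B₀ : complexBetti X 2) (a : ℂ) (c : ℕ → ℂ),
        p ∈ I ∧ I.IsShiftedInitialSegment ∧ IsISemiregular hF {q | q + 1 ∈ I} ∧ IsRationalClass B₀ ∧ B₀ ∈ algebraicClasses X 1 ∧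
        a ≠ 0 ∧ expTwistCh C X B₀ F p = a • w + c p • cupPowTwo θ p ∧ ∀ q ∈ I, q ≠ p → expTwistCh C X B₀ F q = c q • cupPowTwo θ q) :
    AnchoredCarrierAt (twistedReflexiveClass C Adm) n p 𝔄 𝔖 := by
  intro X θ hXθ w hw hwQ
  obtain ⟨I, F, hF, B₀, a, c, hpI, hI, hsr, hBQ, hBalg, ha, hκp, hκq⟩ := h X θ hXθ w hw hwQ
  exact ⟨I, fun q ↦ expTwistCh C X B₀ F q, a, c, hpI,
    twistedReflexiveClass_of_isISemiregular_twisted_prime hAdm' F hF hsr hI hBQ hBalg (fun _ _ ↦ rfl), ha, hκp, hκq⟩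

/-- **THE `I = {1, …, p}` FORM** (the primed twin of `anchoredCarrierAt_twisted_of_forall_exists_isISemiregular`, which used `I = {p}`): at every
anchor and served rational `w`, a finite locally free `F` that is `{0, …, p−1}`-SEMIREGULAR (`(σ₀,…,σ_{p−1})` jointly injective on `Ext²(F,F)`), a
rational algebraic `B₀`, `a ≠ 0` and scalars with `(e^{B₀} ch F)_p = a·w + c_p·θᵖ` AND THE LOWER SIDES `(e^{B₀} ch F)_q = c_q·θ^q`, `1 ≤ q < p`,
give `AnchoredCarrierAt (twistedReflexiveClass C Adm) n p 𝔄 𝔖` for every `Adm ⊇ bfSingleAdmissible'` (`p ≥ 1`).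
[cite: BuchweitzFlenner2003, §5 (I-semiregular) and Thm. 5.1] [cite: Pridham2024Semiregularity, Cor. 2.25 and Rem. 2.26] [cite: Bloch1972Semiregularity, Remark (7.5)] -/
theorem anchoredCarrierAt_twisted_of_forall_exists_isISemiregular_Icc (hp : 1 ≤ p)
    (hAdm' : ∀ n X₀ I E, bfSingleAdmissible' n X₀ I E → Adm n X₀ I E)
    (h : ∀ (X : SchemeOver ℂ) (θ : complexBetti X 2), 𝔄 X θ → ∀ w ∈ 𝔖 X θ, IsRationalClass w →
      ∃ (F : X.left.Modules) (hF : IsFiniteLocallyFree F) (B₀ : complexBetti X 2) (a : ℂ) (c : ℕ → ℂ),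
        IsISemiregular hF (Set.Iio p) ∧ IsRationalClass B₀ ∧ B₀ ∈ algebraicClasses X 1 ∧ a ≠ 0 ∧
        expTwistCh C X B₀ F p = a • w + c p • cupPowTwo θ p ∧ ∀ q, 1 ≤ q → q < p → expTwistCh C X B₀ F q = c q • cupPowTwo θ q) :
    AnchoredCarrierAt (twistedReflexiveClass C Adm) n p 𝔄 𝔖 := by
  refine anchoredCarrierAt_twisted_of_forall_exists_isISemiregular_prime hAdm' fun X θ hXθ w hw hwQ ↦ ?_
  obtain ⟨F, hF, B₀, a, c, hsr, hBQ, hBalg, ha, hκp, hκq⟩ := h X θ hXθ w hw hwQ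
  refine ⟨Finset.Icc 1 p, F, hF, B₀, a, c, Finset.mem_Icc.2 ⟨hp, le_rfl⟩, Finset.isShiftedInitialSegment_Icc le_rfl p,
    by rw [setOf_succ_mem_Icc]; exact hsr, hBQ, hBalg, ha, hκp, fun q hq hqp ↦ ?_⟩
  obtain ⟨h1, hqp'⟩ := Finset.mem_Icc.1 hq
  exact hκq q h1 (lt_of_le_of_ne hqp' hqp)

end Constructors

/-! ## §3 The honest price: on the primed BF door the anchored-carrier statement IS the sheaf-level problem with all lower sides -/

section Price

variable {C : ChernCharacterBetti} {n p : ℕ} {𝔄 : ∀ X : SchemeOver ℂ, complexBetti X 2 → Prop}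
  {𝔖 : ∀ (X : SchemeOver ℂ), complexBetti X 2 → Set (complexBetti X (2 * p))}

/-- **THE ANCHORED-CARRIER STATEMENT FOR THE PRIMED BUCHWEITZ–FLENNER DOOR `tw C bfSingleAdmissible'` IS EXACTLY THE SHEAF-LEVEL DESIGN PROBLEM**:
at every anchor `(X, θ)` and served rational `w` — a shifted-initial index set `I ∋ p`, a finite locally free `F`, `{q | q+1 ∈ I}`-semiregular, a
rational algebraic `B₀`, `a ≠ 0`, scalars `c_q`, with `(e^{B₀} ch F)_p = a·w + c_p·θᵖ` and `(e^{B₀} ch F)_q = c_q·θ^q` for ALL `q ∈ I ∖ {p} ⊇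
{1, …, p−1}`. (⟹: the door's complex is a single vector bundle in degree `0`, `ch(E•) = ch(F)` by `chPerfect_eq_of_bfSingleAdmissible`; ⟸: §2.)
[cite: BuchweitzFlenner2003, §5 (I-semiregular) and Thm. 5.1] [cite: Perry2026Semiregularity, Thm. 1.1 (hypotheses)]
[cite: Pridham2024Semiregularity, Cor. 2.25 and Rem. 2.26] [cite: Bloch1972Semiregularity, Remark (7.5)] -/
theorem anchoredCarrierAt_bfSingle'_iff :
    AnchoredCarrierAt (twistedReflexiveClass C bfSingleAdmissible') n p 𝔄 𝔖 ↔
      ∀ (X : SchemeOver ℂ) (θ : complexBetti X 2), 𝔄 X θ → ∀ w ∈ 𝔖 X θ, IsRationalClass w →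
        ∃ (I : Finset ℕ) (F : X.left.Modules) (hF : IsFiniteLocallyFree F) (B₀ : complexBetti X 2) (a : ℂ) (c : ℕ → ℂ),
          p ∈ I ∧ I.IsShiftedInitialSegment ∧ IsISemiregular hF {q | q + 1 ∈ I} ∧ IsRationalClass B₀ ∧ B₀ ∈ algebraicClasses X 1 ∧
          a ≠ 0 ∧ expTwistCh C X B₀ F p = a • w + c p • cupPowTwo θ p ∧
          ∀ q ∈ I, q ≠ p → expTwistCh C X B₀ F q = c q • cupPowTwo θ q := by
  refine ⟨fun hA X θ hXθ w hw hwQ ↦ ?_, anchoredCarrierAt_twisted_of_forall_exists_isISemiregular_prime fun _ _ _ _ h ↦ h⟩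
  obtain ⟨I, κ, a, c, hpI, hκ, ha, hκp, hκq⟩ := hA X θ hXθ w hw hwQ
  obtain ⟨E, hE, B₀, ⟨⟨h0, F, hF, ⟨e⟩, hsr⟩, hI⟩, hBQ, hBalg, hκE⟩ := hκ
  have hch : (fun j ↦ chPerfect C X E hE.isFiniteLocallyFree j) = fun j ↦ C.ch X F j :=
    funext fun j ↦ chPerfect_eq_of_bfSingleAdmissible hE h0 e j
  have hk : ∀ q ∈ I, κ q = expTwistCh C X B₀ F q := fun q hq ↦ by
    rw [hκE q hq, hch, expTwistCh_eq_expTwistClasses]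
  refine ⟨I, F, hF, B₀, a, c, hpI, hI, hsr, hBQ, hBalg, ha, ?_, fun q hq hqp ↦ ?_⟩
  · rw [← hk p hpI]; exact hκp
  · rw [← hk q hq]; exact hκq q hq hqp

/-- **THE PRICE OF THE PRIMED DOOR ON THE BF DISJUNCT: every primed BF-carrier has ALL ITS LOWER CLASSES ON THE `θ`-RAY** — at every anchor and
served rational `w` its sheaf datum `(F, B₀)` satisfies `(e^{B₀} ch F)_q ∈ ℂ·θ^q` for EVERY `1 ≤ q < p`, besides `(e^{B₀} ch F)_p = a·w + c·θᵖ`,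
`a ≠ 0` (at `(6,3)`: `κ₁ ∈ ℂθ`, `κ₂ ∈ ℂθ²` — not only `κ₃` prescribed, as the `I = {3}` constructors of the door of record allowed).
[cite: BuchweitzFlenner2003, §5 Thm. 5.1] [cite: Pridham2024Semiregularity, Rem. 2.26 with Cor. 2.25] [cite: Bloch1972Semiregularity, Remark (7.5)] -/
theorem forall_lowerSides_of_anchoredCarrierAt_bfSingle' (hA : AnchoredCarrierAt (twistedReflexiveClass C bfSingleAdmissible') n p 𝔄 𝔖) :
    ∀ (X : SchemeOver ℂ) (θ : complexBetti X 2), 𝔄 X θ → ∀ w ∈ 𝔖 X θ, IsRationalClass w →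
      ∃ (F : X.left.Modules) (_ : IsFiniteLocallyFree F) (B₀ : complexBetti X 2) (a : ℂ) (c : ℕ → ℂ),
        IsRationalClass B₀ ∧ B₀ ∈ algebraicClasses X 1 ∧ a ≠ 0 ∧ expTwistCh C X B₀ F p = a • w + c p • cupPowTwo θ p ∧
        ∀ q, 1 ≤ q → q < p → expTwistCh C X B₀ F q = c q • cupPowTwo θ q := by
  intro X θ hXθ w hw hwQ
  obtain ⟨I, F, hF, B₀, a, c, hpI, hI, -, hBQ, hBalg, ha, hκp, hκq⟩ := anchoredCarrierAt_bfSingle'_iff.1 hA X θ hXθ w hw hwQ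
  exact ⟨F, hF, B₀, a, c, hBQ, hBalg, ha, hκp, fun q h1 hqp ↦
    hκq q (Icc_subset_of_mem_of_isShiftedInitialSegment hpI hI (Finset.mem_Icc.2 ⟨h1, hqp.le⟩)) hqp.ne⟩

variable {P Q : PerfectAdmissibility} {X₀ : SchemeOver ℂ} {I : Finset ℕ} {κ : (q : ℕ) → complexBetti X₀ (2 * q)}

/-- **A member of a disjunctive door is a member of one of the disjuncts** (and conversely): `tw C (P ∨ Q) = tw C P ∪ tw C Q` as object classes —
so an `AdmTw'`-datum is, datum by datum, σ-gluable or primed-BF. [cite: Perry2026Semiregularity, Thm. 1.1 (hypotheses)] [folklore] -/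
theorem twistedReflexiveClass_or_iff :
    twistedReflexiveClass C (fun n X₀ I E => P n X₀ I E ∨ Q n X₀ I E) n X₀ I κ ↔
      twistedReflexiveClass C P n X₀ I κ ∨ twistedReflexiveClass C Q n X₀ I κ := by
  refine ⟨fun ⟨E, hE, B₀, hA, hBQ, hBalg, hκ⟩ ↦ hA.imp (fun h ↦ ⟨E, hE, B₀, h, hBQ, hBalg, hκ⟩) fun h ↦ ⟨E, hE, B₀, h, hBQ, hBalg, hκ⟩,
    fun h ↦ h.elim (fun h ↦ h.mono fun _ _ _ _ h' ↦ Or.inl h') fun h ↦ h.mono fun _ _ _ _ h' ↦ Or.inr h'⟩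

/-- **Primed BF-carriers are carriers for every disjunctive door `P ∨ bfSingleAdmissible'`** (in particular for `AdmTw'`); there they pay the
price of `forall_lowerSides_of_anchoredCarrierAt_bfSingle'`. [cite: BuchweitzFlenner2003, §5 Thm. 5.1] [cite: Bloch1972Semiregularity, Remark (7.5)] -/
theorem anchoredCarrierAt_or_of_bfSingle' (hA : AnchoredCarrierAt (twistedReflexiveClass C bfSingleAdmissible') n p 𝔄 𝔖) :
    AnchoredCarrierAt (twistedReflexiveClass C (fun n X₀ I E => P n X₀ I E ∨ bfSingleAdmissible' n X₀ I E)) n p 𝔄 𝔖 := by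
  intro X θ hXθ w hw hwQ
  obtain ⟨I, κ, a, c, hpI, hκ, ha, hκp, hκq⟩ := hA X θ hXθ w hw hwQ
  exact ⟨I, κ, a, c, hpI, hκ.mono fun _ _ _ _ h ↦ Or.inr h, ha, hκp, hκq⟩

end Price

/-! ## §4 Markman's normalisation `B₀ = −c₁(F)/r`: the degree-one side is free -/

section Markman

variable (C : ChernCharacterBetti) {X : SchemeOver ℂ}

/-- **`(e^{B} ch F)₁ = ch₁(F) + r·B` when `ch₀(F) = r·1`** (the two terms `B⁰ ∪ ch₁` and `B ∪ ch₀` of the twisted Chern character in degree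
one; `1 ∪ x = x`, `B ∪ 1 = B`). [cite: HuybrechtsStellari2005, §1] [cite: Fulton1998, Example 3.2.3] -/
theorem expTwistCh_one_of_ch_zero (B : complexBetti X 2) (F : X.left.Modules) {r : ℂ}
    (h0 : C.ch X F 0 = r • singularCohomology.one ℂ (ComplexPoints X)) :
    expTwistCh C X B F 1 = C.ch X F 1 + r • B := by
  unfold expTwistCh
  rw [Fin.sum_univ_succ, Fin.sum_univ_one]
  congr 1
  · show ((Nat.factorial 0 : ℕ) : ℂ)⁻¹ • cupProduct _ (cupPowTwo B 0) (C.ch X F (1 - 0)) = C.ch X F 1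
    rw [Nat.factorial_zero, Nat.cast_one, inv_one, one_smul, cupPowTwo_zero]
    exact one_cupProduct _
  · show ((Nat.factorial 1 : ℕ) : ℂ)⁻¹ • cupProduct _ (cupPowTwo B 1) (C.ch X F 0) = r • B
    rw [Nat.factorial_one, Nat.cast_one, inv_one, one_smul, cupPowTwo_one, h0, LinearMap.map_smul]
    exact congrArg (r • ·) (cupProduct_one _)

/-- **MARKMAN'S NORMALISATION KILLS `κ₁`**: for `ch₀(F) = r·1` with `r ≠ 0` and `B₀ := −r⁻¹·ch₁(F)` (the class `κ(F) = ch(F)·e^{−c₁(F)/r}` of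
arXiv:2502.03415 §1.1; `c₁ = ch₁`), `(e^{B₀} ch F)₁ = ch₁ − ch₁ = 0` — so the degree-one side condition of the primed door holds with `c₁ = 0`.
[cite: Markman2025SecantWeil, §1.1 (κ-class) and §7.3] [cite: HuybrechtsStellari2005, §1] -/
theorem expTwistCh_one_markman_eq_zero (F : X.left.Modules) {r : ℂ} (hr : r ≠ 0)
    (h0 : C.ch X F 0 = r • singularCohomology.one ℂ (ComplexPoints X)) :
    expTwistCh C X (-(r⁻¹ • C.ch X F 1)) F 1 = 0 := by
  rw [expTwistCh_one_of_ch_zero C _ F h0, smul_neg, smul_smul, mul_inv_cancel₀ hr, one_smul, add_neg_cancel]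

/-- Markman's `B`-field `−r⁻¹·ch₁(F)` is a RATIONAL class for `r ∈ ℚ` (`ch₁` is rational). [cite: VoisinHodgeI2002, Thm. 11.23]
[cite: Markman2025SecantWeil, §1.1] -/
theorem isRationalClass_markmanBField (F : X.left.Modules) (hF : IsFiniteLocallyFree F) (r : ℚ) :
    IsRationalClass (-(((r : ℂ))⁻¹ • C.ch X F 1)) := by
  have h : -(((r : ℂ))⁻¹ • C.ch X F 1) = ((-r⁻¹ : ℚ) : ℂ) • C.ch X F 1 := by
    rw [Rat.cast_neg, Rat.cast_inv, neg_smul]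
  rw [h]
  exact (C.isRationalClass_ch X F hF.isVectorBundle 1).smul _

/-- Markman's `B`-field `−r⁻¹·ch₁(F)` is an ALGEBRAIC class on a smooth projective `X` (`ch₁(F) ∈ N¹`).
[cite: Fulton1998, Prop. 19.1.2 and Cor. 19.2 (b)] [cite: Markman2025SecantWeil, §1.1] -/
theorem markmanBField_mem_algebraicClasses {N : ℕ} (hX : IsSmoothProjective N X) (F : X.left.Modules) (hF : IsFiniteLocallyFree F)
    (r : ℂ) : -(r⁻¹ • C.ch X F 1) ∈ algebraicClasses X 1 :=
  Submodule.neg_mem _ (Submodule.smul_mem _ _ (C.ch_mem_algebraicClasses hX F hF.isVectorBundle 1))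

variable {C} {Adm : PerfectAdmissibility} {n p : ℕ} {𝔄 : ∀ X : SchemeOver ℂ, complexBetti X 2 → Prop}
  {𝔖 : ∀ (X : SchemeOver ℂ), complexBetti X 2 → Set (complexBetti X (2 * p))}

/-- **THE MARKMAN-NORMALISED CONSTRUCTOR** (`p ≥ 2`, anchors smooth projective of dimension `n`, every `Adm ⊇ bfSingleAdmissible'`): at every
anchor and served rational `w`, a finite locally free `F` OF RANK `r ∈ ℚ^×` (`ch₀(F) = r·1`), `{0, …, p−1}`-semiregular, whose MARKMAN CLASS
`κ(F) := ch(F)·e^{−ch₁(F)/r}` has `κ_q(F) = c_q·θ^q` for `2 ≤ q < p` and `κ_p(F) = a·w + c_p·θᵖ`, `a ≠ 0`, gives the anchored-carrier statement —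
`B₀ = −ch₁(F)/r` is rational and algebraic and `κ₁(F) = 0` AUTOMATICALLY (§4), so neither the `B`-field nor the degree-one side is a datum.
At `(6,3)`: «`F` `{0,1,2}`-semiregular with `κ₂(F) ∈ ℂθ²` and `κ₃(F) ∈ ℂ^×·w + ℂθ³`». [cite: Markman2025SecantWeil, §1.1, §7.3 and Lemma 9.3.6]
[cite: BuchweitzFlenner2003, §5 (I-semiregular) and Thm. 5.1] [cite: Pridham2024Semiregularity, Cor. 2.25 and Rem. 2.26] [cite: Bloch1972Semiregularity, Remark (7.5)] -/
theorem anchoredCarrierAt_twisted_of_forall_exists_markman (hp : 2 ≤ p)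
    (hAdm' : ∀ n X₀ I E, bfSingleAdmissible' n X₀ I E → Adm n X₀ I E)
    (h𝔄 : ∀ (X : SchemeOver ℂ) (θ : complexBetti X 2), 𝔄 X θ → IsSmoothProjective n X)
    (h : ∀ (X : SchemeOver ℂ) (θ : complexBetti X 2), 𝔄 X θ → ∀ w ∈ 𝔖 X θ, IsRationalClass w →
      ∃ (F : X.left.Modules) (hF : IsFiniteLocallyFree F) (r : ℚ) (a : ℂ) (c : ℕ → ℂ),
        r ≠ 0 ∧ C.ch X F 0 = (r : ℂ) • singularCohomology.one ℂ (ComplexPoints X) ∧ IsISemiregular hF (Set.Iio p) ∧ a ≠ 0 ∧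
        expTwistCh C X (-(((r : ℂ))⁻¹ • C.ch X F 1)) F p = a • w + c p • cupPowTwo θ p ∧
        ∀ q, 2 ≤ q → q < p → expTwistCh C X (-(((r : ℂ))⁻¹ • C.ch X F 1)) F q = c q • cupPowTwo θ q) :
    AnchoredCarrierAt (twistedReflexiveClass C Adm) n p 𝔄 𝔖 := by
  refine anchoredCarrierAt_twisted_of_forall_exists_isISemiregular_Icc (le_trans one_le_two hp) hAdm' fun X θ hXθ w hw hwQ ↦ ?_
  obtain ⟨F, hF, r, a, c, hr, h0, hsr, ha, hκp, hκq⟩ := h X θ hXθ w hw hwQ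
  refine ⟨F, hF, -(((r : ℂ))⁻¹ • C.ch X F 1), a, fun q ↦ if q = 1 then 0 else c q, hsr, isRationalClass_markmanBField C F hF r,
    markmanBField_mem_algebraicClasses C (h𝔄 X θ hXθ) F hF _, ha, ?_, fun q h1 hqp ↦ ?_⟩
  · dsimp only
    rw [if_neg (show p ≠ 1 by omega)]
    exact hκp
  · rcases Nat.eq_or_lt_of_le h1 with h1 | h1
    · subst h1
      dsimp only
      rw [if_pos rfl, zero_smul]
      exact expTwistCh_one_markman_eq_zero C F (by exact_mod_cast hr) h0
    · dsimp only
      rw [if_neg (show q ≠ 1 by omega)]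
      exact hκq q h1 hqp

/-- **IN CODIMENSION TWO THE PRIMED DOOR COSTS NO SIDE CONDITION** (the first cell `(4,2)` and every `(n,2)`): rank-`r` vector bundles,
`{0,1}`-semiregular (`(σ₀, σ₁)` jointly injective — for the door of record `σ₁` alone was tested), with `κ₂(F) = ch₂ − ch₁²/2r = a·w + c·θ²`,
`a ≠ 0`, in Markman's normalisation give the primed anchored-carrier statement at `p = 2`: the side range `2 ≤ q < 2` is empty and `κ₁(F) = 0`.
[cite: Markman2025SecantWeil, §1.1 and §7.3] [cite: BuchweitzFlenner2003, §5 (I-semiregular) and Thm. 5.1] [cite: Bloch1972Semiregularity, Remark (7.5)] -/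
theorem anchoredCarrierAt_two_twisted_of_forall_exists_markman
    {𝔖₂ : ∀ (X : SchemeOver ℂ), complexBetti X 2 → Set (complexBetti X (2 * 2))}
    (hAdm' : ∀ n X₀ I E, bfSingleAdmissible' n X₀ I E → Adm n X₀ I E)
    (h𝔄 : ∀ (X : SchemeOver ℂ) (θ : complexBetti X 2), 𝔄 X θ → IsSmoothProjective n X)
    (h : ∀ (X : SchemeOver ℂ) (θ : complexBetti X 2), 𝔄 X θ → ∀ w ∈ 𝔖₂ X θ, IsRationalClass w →
      ∃ (F : X.left.Modules) (hF : IsFiniteLocallyFree F) (r : ℚ) (a c : ℂ),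
        r ≠ 0 ∧ C.ch X F 0 = (r : ℂ) • singularCohomology.one ℂ (ComplexPoints X) ∧ IsISemiregular hF (Set.Iio 2) ∧ a ≠ 0 ∧
        expTwistCh C X (-(((r : ℂ))⁻¹ • C.ch X F 1)) F 2 = a • w + c • cupPowTwo θ 2) :
    AnchoredCarrierAt (twistedReflexiveClass C Adm) n 2 𝔄 𝔖₂ := by
  refine anchoredCarrierAt_twisted_of_forall_exists_markman le_rfl hAdm' h𝔄 fun X θ hXθ w hw hwQ ↦ ?_
  obtain ⟨F, hF, r, a, c, hr, h0, hsr, ha, hκ2⟩ := h X θ hXθ w hw hwQ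
  exact ⟨F, hF, r, a, fun _ ↦ c, hr, h0, hsr, ha, hκ2, fun q h2 hq2 ↦ absurd hq2 (not_lt.2 h2)⟩

end Markman

end Summit.HodgeConjecture.HodgeConjecture.Ring2.SemiregularRepresentatives

end
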